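/-
Copyright (c) 2026 the pub-hodgecm-mathlib formalisation cell (harness21).  Prover seat hodgecm-mathlib-LH4-p08 (g10), req620 Track A «(D-RAM) FOUR-FRAME» squad, helper lane
on h413 = stmt-HodgeConjecture-24833 (count-neutral).  β sub-dealer LH4-p05 (g8) LEDGER #12∕#13: ROW R6 «SPECIAL κ-CLASSES», tower 3 — the (β2-foot) brick, slots 0 and 1
(SPEC on the squad bus 2026-09-04 16:20Z).  2026-09-04.
-/
import Summits.HodgeConjecture.HodgeConjecture.Theorems.F0P3cDyRamLabelledOddBoundaryIndicatorsG3
import HarnessLib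

/-!
# Crux `H413`, line LH4 «(D-RAM) FOUR-FRAME» — (β) Stage B, β-BOARD row R6 (tower 3), STEP (β2-foot): the slot-0 and slot-1 INDICATORS of the character
# `λ(u) = ω(u₀)·ω(1 + (u₁∕u₀ − 1)·c)` on the fixed stabiliser of a G₃ representative when the correction coefficient has `|c| = |ϖ^s|⁻¹` (the κ-CLASS FOOT): `𝟙₀ = 𝟙₁ = [2d − 1 ≤ ρ]`

Cell `hodgecm-mathlib` (D-0151), FLOOR 0, crux item H413 = `stmt-HodgeConjecture-24833`, route `HCCMUnconditional`; squad F0∕P3c∕LH4.  THEOREMS ONLY (no `def`, no instance, no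
notation, no `sorry`, default heartbeats); ★-only imports; lane `--supports stmt-HodgeConjecture-24833 --as helper` (count-neutral); pays NO row, states NO law.

THE MATHEMATICS.  ★ p861783 (LH4-p11 (g9)) reads the labelled odd value of a G₃ normal form `M₀ = latt (1 0 0; x ϖ^{ρ+s} 0; y z ϖ^{2ρ})` at the κ-class FOOT (`2ρ + ℓ₀ = n₁ = n₂`) as
`ω(S)·ω(D_i)∕2 · 𝟙_i · w`, `𝟙_i = [∀ u ∈ S_F(M₀), ω(u_i)·ω(u₀)·ω(1 + (u₁∕u₀ − 1)·c) = 1]`, `c = G₁∕S`; ★ p862059 (this seat) closes the signs.  At the foot `|S| = 1` is led by the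
`e_B`-term and `|c| = |G₁| = |ϖ^s|⁻¹` (for LH4-p18 (g0)'s representatives `c(g) = ((1+g)κ′ − g)⁻¹`), whereas at the READ (★ p861738 `…BoundaryIndicatorsG3`) `|c| = |ϖ|^{n₁−n₃}`.
This file is the foot twin of ★ p861738 §2 for slots 0 and 1, with the correction coefficient kept ABSTRACT (`σc = c`, `|c|·|ϖ^s| = 1`):
* §1 `indicator_zero_latt_G3_foot_iff` : `𝟙₀ ↔ 2d − 1 ≤ ρ` — the correction `(u₁∕u₀ − 1)·c` sweeps the fixed ball of depth `ρ` through the witnesses `u(a) = (1, 1+a, 1−a∕g)`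
  (★ `witness_mem_fixedUnitStabilizer_latt_G3`); killer `a = (c′−1)∕c`, `c′` the ★ non-norm unit `≡ 1 (mod ϖ^{2d−2})` (`|2| < 1`).
* §2 `indicator_one_latt_G3_foot_iff` : `𝟙₁ ↔ 2d − 1 ≤ ρ` — `ω(u₁)ω(u₀) = ω(u₁∕u₀)`, `|u₁∕u₀ − 1| ≤ |ϖ|^{ρ+s}`; killer `a = (c′−1)∕(1+c)`: `(1+a)(1+ac) = c′(1 + a²c∕c′)`.
Slot 2 (where the two factors are NOT separately norms below the conductor) and the closed forms on the representatives are the sequel `…KappaClassIndicatorTwoG3`.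
HONEST LABEL.  Count-neutral; the κ-row, hRest, (β-BAL), (β), T₊ remain OPEN; `HC_CM` is proved only modulo the 7 printed citations (2 remaining named inputs: hLiu418 =
`stmt-HodgeConjecture-24832`, h413 = `stmt-HodgeConjecture-24833`) until rung 0 closes.

## References
* [Serre1979] J.-P. Serre, *Local Fields*, GTM 67 (1979), Ch. V §3 Prop. 5, Cor. 2–3; Ch. XV §2 (norm residue symbol, conductor `2d − 1` of a ramified quadratic extension).
* [Kottwitz1986BaseChangeUnits] R. E. Kottwitz, *Base change for unit elements of Hecke algebras*, Compositio Math. 60 (1986), §1 pp. 240–241 (torus stabilisers).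
* [LanglandsShelstad1987] R. P. Langlands, D. Shelstad, *On the definition of transfer factors*, Math. Ann. 278 (1987), §3.
-/

set_option autoImplicit false

noncomputable section

namespace Summit.HodgeConjecture.HodgeConjecture.Cruxes.H413.F0P3cDyRamLabelledOddKappaClassIndicatorsG3

open Literature.NumberTheory.Automorphic Literature.NumberTheory.Automorphic.HermitianLattice
open Literature.NumberTheory.Automorphic.UnitaryLatticeTree Literature.NumberTheory.Automorphic.UnitaryThreeFourFrame
open Literature.NumberTheory.LocalFields Literature.NumberTheory.LocalFields.WildQuadraticDatum
open Summit.HodgeConjecture.HodgeConjecture.Cruxes.H413.F0P3cDyRamFourFramePieces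
open Summit.HodgeConjecture.HodgeConjecture.Cruxes.H413.F0P3cDyRamDiagonalTorusDefs
open Summit.HodgeConjecture.HodgeConjecture.Cruxes.H413.F0P3cDyRamDiagonalStrataDefs
open Summit.HodgeConjecture.HodgeConjecture.Cruxes.H413.F0P3cDyRamDiagonalGluedStratumG3
open Summit.HodgeConjecture.HodgeConjecture.Cruxes.H413.F0P3cDyRamLabelledOddBoundaryIndicatorsG3 (witness_mem_fixedUnitStabilizer_latt_G3)
open Summit.HodgeConjecture.HodgeConjecture.Cruxes.H413.F0P3cDyRamDiagonalKappaSplitCountEval (normSign_mul_self)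
open scoped Valued WithZero Matrix MatrixGroups

variable {K : Type} [Field K] [Valued K ℤᵐ⁰] [CompleteSpace K] [Fintype 𝓀[K]] {σ : K →+* K} {ϖ : K} {d t : ℕ}

/-! ## §1  The slot-0 indicator at the foot: `[∀ u ∈ S_F, ω(u₀)·ω(u₀)·ω(1 + (u₁∕u₀ − 1)c) = 1] ↔ 2d − 1 ≤ ρ` -/

/-- **THE SLOT-0 INDICATOR AT THE FOOT.**  G₃ representative letters (`|x| = 1`, `|z| = |ϖ^ρ|`, `x z = −yϖ^{ρ+s}g⁻¹`, `g ∈ F`, `|g| = |ϖ^s|`), and a σ-fixed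
correction coefficient `c` of valuation `|ϖ^s|⁻¹` (at the κ-class foot `c = G₁∕S = −(g − (1+g)κ′)⁻¹`).  Then
`(∀ u ∈ S_F(M₀), ω(u₀)·(ω(u₀)·ω(1 + (u₁∕u₀ − 1)·c)) = 1) ↔ 2d − 1 ≤ ρ`: the correction `(u₁∕u₀ − 1)·c` sweeps the fixed ball of depth `ρ` (witnesses `(1, 1+a, 1−a∕g)`,
★ `witness_mem_fixedUnitStabilizer_latt_G3`; killer `a = (c′−1)∕c`, `c′` the ★ non-norm unit `≡ 1 (mod ϖ^{2d−2})`). [cite: Serre1979, Ch. V §3 Cor. 3; Ch. XV §2]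
[cite: Kottwitz1986BaseChangeUnits, §1 pp. 240–241] -/
theorem indicator_zero_latt_G3_foot_iff (hD : IsRamifiedQuadraticDatum σ ϖ d t) (h2 : Valued.v (2 : K) < 1)
    {ρ s : ℕ} (hρ : 1 ≤ ρ) (hs : 1 ≤ s) {x y z g : K} (hx : Valued.v x = 1) (hz : Valued.v z = Valued.v (ϖ ^ ρ))
    (hσg : σ g = g) (hg : Valued.v g = Valued.v (ϖ ^ s)) (hxyz : x * z = -(y * ϖ ^ (ρ + s) * g⁻¹))
    {M₀ : Submodule 𝒪[K] (Fin 3 → K)} (hM₀ : M₀ = latt (!![1, 0, 0; x, ϖ ^ (ρ + s), 0; y, z, ϖ ^ (2 * ρ)] : Matrix (Fin 3) (Fin 3) K))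
    {c : K} (hσc : σ c = c) (hcv : Valued.v c * Valued.v (ϖ ^ s) = 1) :
    (∀ u ∈ fixedUnitStabilizer σ M₀,
        normSign σ ((u 0 : Kˣ) : K) * (normSign σ ((u 0 : Kˣ) : K) * normSign σ (1 + (((u 1 : Kˣ) : K) / ((u 0 : Kˣ) : K) - 1) * c)) = 1) ↔
      2 * d - 1 ≤ ρ := by
  obtain ⟨hσ, -, hϖ, -, -, hd1, -⟩ := id hD
  haveI : Finite 𝓀[K] := Finite.of_fintype _
  have hϖ0 : ϖ ≠ 0 := fun h0 => by rw [h0, map_zero] at hϖ; exact WithZero.coe_ne_zero hϖ.symm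
  have hϖ1 : Valued.v ϖ ≤ 1 := by rw [hϖ, ← WithZero.exp_zero, WithZero.exp_le_exp]; norm_num
  have hϖlt : Valued.v ϖ < 1 := by rw [hϖ, ← WithZero.exp_zero, WithZero.exp_lt_exp]; norm_num
  have hq : ∀ n : ℕ, Valued.v (ϖ ^ n) = WithZero.exp (-(n : ℤ)) := fun n => by rw [map_pow, v_varpi_pow hϖ]
  have hcv' : Valued.v c = WithZero.exp ((s : ℕ) : ℤ) := by
    rw [hq] at hcv
    calc Valued.v c = Valued.v c * WithZero.exp (-((s : ℕ) : ℤ)) * WithZero.exp ((s : ℕ) : ℤ) := by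
          rw [mul_assoc, ← WithZero.exp_add, neg_add_cancel, WithZero.exp_zero, mul_one]
      _ = WithZero.exp ((s : ℕ) : ℤ) := by rw [hcv, one_mul]
  have hc0 : c ≠ 0 := fun h => by rw [h, map_zero] at hcv'; exact WithZero.coe_ne_zero hcv'.symm
  -- the correction on the stabiliser tube: `|(u₁∕u₀ − 1)·c| ≤ |ϖ|^ρ`
  have hcorr : ∀ u ∈ fixedUnitStabilizer σ M₀, Valued.v ((((u 1 : Kˣ) : K) / ((u 0 : Kˣ) : K) - 1) * c) ≤ Valued.v ϖ ^ ρ := by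
    intro u hu
    have hu' := hu
    rw [hM₀] at hu'
    have h10 := (v_sub_le_of_mem_fixedUnitStabilizer_latt_G3 σ hϖ0 hϖ1 hx hz hu').1
    obtain ⟨huv, -⟩ := (mem_fixedUnitTorus_iff σ u).1 (Subgroup.mem_inf.1 (show u ∈ fixedUnitStabilizer σ M₀ from hu)).2
    rw [show ((u 1 : Kˣ) : K) / ((u 0 : Kˣ) : K) - 1 = (((u 1 : Kˣ) : K) - (u 0 : Kˣ)) / ((u 0 : Kˣ) : K) by field_simp, map_mul, map_div₀, huv 0,
      div_one, ← map_pow]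
    calc Valued.v (((u 1 : Kˣ) : K) - (u 0 : Kˣ)) * Valued.v c ≤ Valued.v (ϖ ^ (ρ + s)) * Valued.v c := by gcongr
      _ = Valued.v (ϖ ^ ρ) := by rw [pow_add, map_mul, mul_assoc, mul_comm (Valued.v (ϖ ^ s)), hcv, mul_one]
  constructor
  · -- (⇒): for `ρ ≤ 2d − 2` a killer exists
    intro hall
    by_contra hlt
    obtain ⟨c', hσc', hc'1, hc'v, hc'n⟩ := exists_fixed_unit_not_norm_v_sub_one_le hD h2
    set a : K := (c' - 1) / c with hadef
    have hσa : σ a = a := by rw [hadef, map_div₀, map_sub, hσc', map_one, hσc]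
    have ha : Valued.v a ≤ Valued.v (ϖ ^ (ρ + s)) := by
      rw [hadef, map_div₀, hcv', hq, div_eq_mul_inv, ← WithZero.exp_neg]
      calc Valued.v (c' - 1) * WithZero.exp (-((s : ℕ) : ℤ))
          ≤ WithZero.exp (-(2 * ((d - 1 : ℕ) : ℤ))) * WithZero.exp (-((s : ℕ) : ℤ)) := by gcongr
        _ ≤ WithZero.exp (-((ρ + s : ℕ) : ℤ)) := by rw [← WithZero.exp_add, WithZero.exp_le_exp]; push_cast; omega
    have ha1 : Valued.v a < 1 := ha.trans_lt (by rw [map_pow]; exact pow_lt_one₀ zero_le hϖlt (by omega))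
    have hg0 : g ≠ 0 := fun h => by
      rw [h, map_zero] at hg; exact (Valuation.ne_zero_iff Valued.v |>.2 (pow_ne_zero s hϖ0)) hg.symm
    have hag1 : Valued.v (a / g) < 1 := by
      rw [map_div₀, hg, div_lt_iff₀ ((Valuation.pos_iff _).2 (pow_ne_zero _ hϖ0))]
      refine ha.trans_lt ?_
      rw [one_mul, hq, hq, WithZero.exp_lt_exp]; omega
    have h1 : (1 + a : K) ≠ 0 := fun h => by
      have := Valued.v.map_one_add_of_lt ha1; rw [h, map_zero] at this; exact zero_ne_one this
    have h2' : (1 - a / g : K) ≠ 0 := fun h => by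
      have := Valued.v.map_one_add_of_lt (x := -(a / g)) (by rw [Valuation.map_neg]; exact hag1)
      rw [← sub_eq_add_neg, h, map_zero] at this; exact zero_ne_one this
    have hmem := witness_mem_fixedUnitStabilizer_latt_G3 hϖ hρ hx hz hσg hg hxyz hσa ha h1 h2'
    rw [← hM₀] at hmem
    have hval := hall _ hmem
    have hu0 : (((![1, Units.mk0 (1 + a) h1, Units.mk0 (1 - a / g) h2'] : Fin 3 → Kˣ) 0 : Kˣ) : K) = 1 := rfl
    have hu1 : (((![1, Units.mk0 (1 + a) h1, Units.mk0 (1 - a / g) h2'] : Fin 3 → Kˣ) 1 : Kˣ) : K) = 1 + a := rfl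
    rw [hu0, hu1, div_one, add_sub_cancel_left, show (1 + a * c : K) = c' by rw [hadef, div_mul_cancel₀ _ hc0]; ring,
      (show normSign σ (1 : K) = 1 from normSign_of_isNorm σ ⟨1, by rw [map_one, one_mul]⟩), normSign_of_not_isNorm σ hc'n] at hval
    norm_num at hval
  · -- (⇐): for `ρ ≥ 2d − 1` the correction is a norm
    intro hdepth u hu
    rw [← mul_assoc, normSign_mul_self, one_mul]
    obtain ⟨-, huσ⟩ := (mem_fixedUnitTorus_iff σ u).1 (Subgroup.mem_inf.1 (show u ∈ fixedUnitStabilizer σ M₀ from hu)).2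
    have hσw : σ (1 + (((u 1 : Kˣ) : K) / ((u 0 : Kˣ) : K) - 1) * c) = 1 + (((u 1 : Kˣ) : K) / ((u 0 : Kˣ) : K) - 1) * c := by
      rw [map_add, map_one, map_mul, map_sub, map_div₀, huσ 1, huσ 0, map_one, hσc]
    exact normSign_eq_one_of_fixed_of_v_sub_one_le hD hσw hdepth (by rw [add_sub_cancel_left]; exact hcorr u hu)

/-! ## §2  The slot-1 indicator at the foot: `[∀ u ∈ S_F, ω(u₁)·ω(u₀)·ω(1 + (u₁∕u₀ − 1)c) = 1] ↔ 2d − 1 ≤ ρ` -/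

/-- **THE SLOT-1 INDICATOR AT THE FOOT.**  Same letters as `indicator_zero_latt_G3_foot_iff`:
`(∀ u ∈ S_F(M₀), ω(u₁)·(ω(u₀)·ω(1 + (u₁∕u₀ − 1)·c)) = 1) ↔ 2d − 1 ≤ ρ` — `ω(u₁)ω(u₀) = ω(u₁∕u₀)` with `|u₁∕u₀ − 1| ≤ |ϖ|^{ρ+s}` on `S_F` (★ tube); for `ρ ≥ 2d − 1` both factors
are norms, for `ρ ≤ 2d − 2` the killer is `(1, 1+a, 1−a∕g)` with `a = (c′−1)∕(1+c)` (`|1 + c| = |ϖ^s|⁻¹`): `(1+a)(1+ac) = c′·(1 + a²c∕c′)`. [cite: Serre1979, Ch. V §3 Cor. 3; Ch. XV §2]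
[cite: Kottwitz1986BaseChangeUnits, §1 pp. 240–241] -/
theorem indicator_one_latt_G3_foot_iff (hD : IsRamifiedQuadraticDatum σ ϖ d t) (h2 : Valued.v (2 : K) < 1)
    {ρ s : ℕ} (hρ : 1 ≤ ρ) (hs : 1 ≤ s) {x y z g : K} (hx : Valued.v x = 1) (hz : Valued.v z = Valued.v (ϖ ^ ρ))
    (hσg : σ g = g) (hg : Valued.v g = Valued.v (ϖ ^ s)) (hxyz : x * z = -(y * ϖ ^ (ρ + s) * g⁻¹))
    {M₀ : Submodule 𝒪[K] (Fin 3 → K)} (hM₀ : M₀ = latt (!![1, 0, 0; x, ϖ ^ (ρ + s), 0; y, z, ϖ ^ (2 * ρ)] : Matrix (Fin 3) (Fin 3) K))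
    {c : K} (hσc : σ c = c) (hcv : Valued.v c * Valued.v (ϖ ^ s) = 1) :
    (∀ u ∈ fixedUnitStabilizer σ M₀,
        normSign σ ((u 1 : Kˣ) : K) * (normSign σ ((u 0 : Kˣ) : K) * normSign σ (1 + (((u 1 : Kˣ) : K) / ((u 0 : Kˣ) : K) - 1) * c)) = 1) ↔
      2 * d - 1 ≤ ρ := by
  obtain ⟨hσ, -, hϖ, -, -, hd1, -⟩ := id hD
  haveI : Finite 𝓀[K] := Finite.of_fintype _
  have hϖ0 : ϖ ≠ 0 := fun h0 => by rw [h0, map_zero] at hϖ; exact WithZero.coe_ne_zero hϖ.symm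
  have hϖ1 : Valued.v ϖ ≤ 1 := by rw [hϖ, ← WithZero.exp_zero, WithZero.exp_le_exp]; norm_num
  have hϖlt : Valued.v ϖ < 1 := by rw [hϖ, ← WithZero.exp_zero, WithZero.exp_lt_exp]; norm_num
  have hq : ∀ n : ℕ, Valued.v (ϖ ^ n) = WithZero.exp (-(n : ℤ)) := fun n => by rw [map_pow, v_varpi_pow hϖ]
  have hcv' : Valued.v c = WithZero.exp ((s : ℕ) : ℤ) := by
    rw [hq] at hcv
    calc Valued.v c = Valued.v c * WithZero.exp (-((s : ℕ) : ℤ)) * WithZero.exp ((s : ℕ) : ℤ) := by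
          rw [mul_assoc, ← WithZero.exp_add, neg_add_cancel, WithZero.exp_zero, mul_one]
      _ = WithZero.exp ((s : ℕ) : ℤ) := by rw [hcv, one_mul]
  have hc0 : c ≠ 0 := fun h => by rw [h, map_zero] at hcv'; exact WithZero.coe_ne_zero hcv'.symm
  -- the tube and the correction on the stabiliser
  have htube : ∀ u ∈ fixedUnitStabilizer σ M₀, Valued.v (((u 1 : Kˣ) : K) / ((u 0 : Kˣ) : K) - 1) ≤ Valued.v (ϖ ^ (ρ + s)) := by
    intro u hu
    have hu' := hu
    rw [hM₀] at hu'
    have h10 := (v_sub_le_of_mem_fixedUnitStabilizer_latt_G3 σ hϖ0 hϖ1 hx hz hu').1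
    obtain ⟨huv, -⟩ := (mem_fixedUnitTorus_iff σ u).1 (Subgroup.mem_inf.1 (show u ∈ fixedUnitStabilizer σ M₀ from hu)).2
    rw [show ((u 1 : Kˣ) : K) / ((u 0 : Kˣ) : K) - 1 = (((u 1 : Kˣ) : K) - (u 0 : Kˣ)) / ((u 0 : Kˣ) : K) by field_simp, map_div₀, huv 0, div_one]
    exact h10
  have hcorr : ∀ u ∈ fixedUnitStabilizer σ M₀, Valued.v ((((u 1 : Kˣ) : K) / ((u 0 : Kˣ) : K) - 1) * c) ≤ Valued.v ϖ ^ ρ := by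
    intro u hu
    rw [map_mul, ← map_pow]
    calc Valued.v (((u 1 : Kˣ) : K) / ((u 0 : Kˣ) : K) - 1) * Valued.v c ≤ Valued.v (ϖ ^ (ρ + s)) * Valued.v c := by gcongr; exact htube u hu
      _ = Valued.v (ϖ ^ ρ) := by rw [pow_add, map_mul, mul_assoc, mul_comm (Valued.v (ϖ ^ s)), hcv, mul_one]
  constructor
  · -- (⇒): for `ρ ≤ 2d − 2` a killer exists
    intro hall
    by_contra hlt
    obtain ⟨c', hσc', hc'1, hc'v, hc'n⟩ := exists_fixed_unit_not_norm_v_sub_one_le hD h2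
    have hc'0 : c' ≠ 0 := fun h => by rw [h, map_zero] at hc'1; exact zero_ne_one hc'1
    -- `|1 + c| = |ϖ^s|⁻¹`
    have h1c : Valued.v (1 + c) = WithZero.exp ((s : ℕ) : ℤ) := by
      rw [add_comm, Valuation.map_add_eq_of_lt_left _ (by rw [hcv', map_one, ← WithZero.exp_zero, WithZero.exp_lt_exp]; omega), hcv']
    have h1c0 : (1 + c : K) ≠ 0 := fun h => by rw [h, map_zero] at h1c; exact WithZero.coe_ne_zero h1c.symm
    set a : K := (c' - 1) / (1 + c) with hadef
    have hσa : σ a = a := by rw [hadef, map_div₀, map_sub, hσc', map_one, map_add, map_one, hσc]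
    have hav : Valued.v a ≤ WithZero.exp (-(2 * ((d - 1 : ℕ) : ℤ)) - s) := by
      rw [hadef, map_div₀, h1c, div_eq_mul_inv, ← WithZero.exp_neg, sub_eq_add_neg (-(2 * ((d - 1 : ℕ) : ℤ))), WithZero.exp_add]
      gcongr
    have ha : Valued.v a ≤ Valued.v (ϖ ^ (ρ + s)) := by
      refine hav.trans ?_
      rw [hq, WithZero.exp_le_exp]; push_cast; omega
    have ha1 : Valued.v a < 1 := ha.trans_lt (by rw [map_pow]; exact pow_lt_one₀ zero_le hϖlt (by omega))
    have hg0 : g ≠ 0 := fun h => by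
      rw [h, map_zero] at hg; exact (Valuation.ne_zero_iff Valued.v |>.2 (pow_ne_zero s hϖ0)) hg.symm
    have hag1 : Valued.v (a / g) < 1 := by
      rw [map_div₀, hg, div_lt_iff₀ ((Valuation.pos_iff _).2 (pow_ne_zero _ hϖ0))]
      refine ha.trans_lt ?_
      rw [one_mul, hq, hq, WithZero.exp_lt_exp]; omega
    have h1 : (1 + a : K) ≠ 0 := fun h => by
      have := Valued.v.map_one_add_of_lt ha1; rw [h, map_zero] at this; exact zero_ne_one this
    have h2' : (1 - a / g : K) ≠ 0 := fun h => by
      have := Valued.v.map_one_add_of_lt (x := -(a / g)) (by rw [Valuation.map_neg]; exact hag1)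
      rw [← sub_eq_add_neg, h, map_zero] at this; exact zero_ne_one this
    have hmem := witness_mem_fixedUnitStabilizer_latt_G3 hϖ hρ hx hz hσg hg hxyz hσa ha h1 h2'
    rw [← hM₀] at hmem
    have hval := hall _ hmem
    have hu0 : (((![1, Units.mk0 (1 + a) h1, Units.mk0 (1 - a / g) h2'] : Fin 3 → Kˣ) 0 : Kˣ) : K) = 1 := rfl
    have hu1 : (((![1, Units.mk0 (1 + a) h1, Units.mk0 (1 - a / g) h2'] : Fin 3 → Kˣ) 1 : Kˣ) : K) = 1 + a := rfl
    rw [hu0, hu1, div_one, add_sub_cancel_left, (show normSign σ (1 : K) = 1 from normSign_of_isNorm σ ⟨1, by rw [map_one, one_mul]⟩), one_mul] at hval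
    -- `(1 + a)(1 + ac) = c′·w`, `w = 1 + a²c∕c′`, `|w − 1| ≤ |ϖ|^{2d−1}`
    have hσ1a : σ (1 + a) = 1 + a := by rw [map_add, map_one, hσa]
    have hσac : σ (1 + a * c) = 1 + a * c := by rw [map_add, map_one, map_mul, hσa, hσc]
    have hac1 : Valued.v (a * c) < 1 := by
      rw [map_mul]
      calc Valued.v a * Valued.v c ≤ Valued.v (ϖ ^ (ρ + s)) * Valued.v c := by gcongr
        _ < 1 := by rw [hq, hcv', ← WithZero.exp_add, ← WithZero.exp_zero, WithZero.exp_lt_exp]; push_cast; omega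
    have hac0 : (1 + a * c : K) ≠ 0 := fun h => by
      have := Valued.v.map_one_add_of_lt hac1; rw [h, map_zero] at this; exact zero_ne_one this
    rw [← normSign_mul_of_fixed hD hσ1a hσac h1 hac0] at hval
    set w : K := 1 + a ^ 2 * c / c' with hwdef
    have hprod : (1 + a) * (1 + a * c) = c' * w := by
      have hkey : a * (1 + c) = c' - 1 := by rw [hadef, div_mul_cancel₀ _ h1c0]
      have e1 : (1 + a) * (1 + a * c) = 1 + a * (1 + c) + a ^ 2 * c := by ring
      have e2 : c' * w = c' + a ^ 2 * c := by rw [hwdef, mul_add, mul_one, mul_div_cancel₀ _ hc'0]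
      rw [e1, e2, hkey]; ring
    have hσw : σ w = w := by rw [hwdef, map_add, map_one, map_div₀, map_mul, map_pow, hσa, hσc, hσc']
    have hwv : Valued.v (w - 1) ≤ Valued.v ϖ ^ (2 * d - 1) := by
      rw [hwdef, add_sub_cancel_left, map_div₀, map_mul, map_pow, hc'1, div_one, hcv', v_varpi_pow hϖ]
      calc Valued.v a ^ 2 * WithZero.exp ((s : ℕ) : ℤ)
          ≤ WithZero.exp (-(2 * ((d - 1 : ℕ) : ℤ)) - s) ^ 2 * WithZero.exp ((s : ℕ) : ℤ) := mul_le_mul' (pow_le_pow_left' hav 2) le_rfl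
        _ ≤ WithZero.exp (-((2 * d - 1 : ℕ) : ℤ)) := by
          rw [← WithZero.exp_nsmul, nsmul_eq_mul, ← WithZero.exp_add, WithZero.exp_le_exp]; push_cast; omega
    rw [hprod, normSign_mul_eq_neg_of_not_norm hD hσc' hc'n hσw ?_] at hval
    · have hw1 : normSign σ w = 1 := normSign_eq_one_of_fixed_of_v_sub_one_le hD hσw (le_refl _) hwv
      rw [hw1] at hval
      norm_num at hval
    · intro h
      rw [h, zero_sub, Valuation.map_neg, map_one] at hwv
      have : Valued.v ϖ ^ (2 * d - 1) < 1 := pow_lt_one₀ zero_le hϖlt (by omega)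
      exact absurd (hwv.trans_lt this) (lt_irrefl _)
  · -- (⇐): for `ρ ≥ 2d − 1` every factor is a norm
    intro hdepth u hu
    obtain ⟨huv, huσ⟩ := (mem_fixedUnitTorus_iff σ u).1 (Subgroup.mem_inf.1 (show u ∈ fixedUnitStabilizer σ M₀ from hu)).2
    have hσw : σ (1 + (((u 1 : Kˣ) : K) / ((u 0 : Kˣ) : K) - 1) * c) = 1 + (((u 1 : Kˣ) : K) / ((u 0 : Kˣ) : K) - 1) * c := by
      rw [map_add, map_one, map_mul, map_sub, map_div₀, huσ 1, huσ 0, map_one, hσc]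
    have hw1 : normSign σ (1 + (((u 1 : Kˣ) : K) / ((u 0 : Kˣ) : K) - 1) * c) = 1 :=
      normSign_eq_one_of_fixed_of_v_sub_one_le hD hσw hdepth (by rw [add_sub_cancel_left]; exact hcorr u hu)
    rw [hw1, mul_one, ← normSign_mul_of_fixed hD (huσ 1) (huσ 0) (u 1).ne_zero (u 0).ne_zero]
    have hv : Valued.v (((u 1 : Kˣ) : K) / ((u 0 : Kˣ) : K) - 1) ≤ Valued.v ϖ ^ ρ := by
      refine (htube u hu).trans ?_
      rw [map_pow, pow_add]; exact mul_le_of_le_one_right' (pow_le_one' hϖ1 _)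
    have hσv : σ (((u 1 : Kˣ) : K) / ((u 0 : Kˣ) : K)) = ((u 1 : Kˣ) : K) / ((u 0 : Kˣ) : K) := by rw [map_div₀, huσ 1, huσ 0]
    rw [show ((u 1 : Kˣ) : K) * ((u 0 : Kˣ) : K) = ((u 0 : Kˣ) : K) * ((u 0 : Kˣ) : K) * (((u 1 : Kˣ) : K) / ((u 0 : Kˣ) : K)) by field_simp,
      normSign_mul_eq_of_fixed_of_v_sub_one_le hD _ hσv hdepth hv]
    exact normSign_of_isNorm σ ⟨((u 0 : Kˣ) : K), by rw [huσ 0]⟩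

end Summit.HodgeConjecture.HodgeConjecture.Cruxes.H413.F0P3cDyRamLabelledOddKappaClassIndicatorsG3

end
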